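import Summits.BirchSwinnertonDyer.BirchSwinnertonDyer.Theorems.SignedLowerHalvesKobayashiLowerHalfLargeImageParityStratum
import Summits.BirchSwinnertonDyer.BirchSwinnertonDyer.Theorems.SignedLowerHalvesKobayashiMainConjectureSmallImageMuSaturation
import Literature.NumberTheory.EllipticCurves.Sprung2017.SharpFlatFunctionalEquationApZeroProofs
import HarnessLib

/-!
# Route `SignedLowerHalves`, cruxes 3/4 (`KobayashiLowerHalfLargeImage` / `KobayashiMainConjectureSmallImage`):
# the PARITY STRATUM, part 5 — the IMAGE-FREE, RANK-FREE signed main-conjecture squeeze: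
# `μ(X^ε) = 0` + certificate `(μ, λ)(L_p^ε) = (0, 1)` + `p`-parity ⇒ `KobayashiMainConjecture W p ε`
# (cell `bsd-ssimc`, seat `bsd-line-slh-p1` LEAD gen 12; helper file `--supports 19001`; the statement is
# class-free and serves item stmt-BirchSwinnertonDyer-19002 verbatim — cc lineage `bsd-line-slh-p3`)

HONEST FRAMING: both cruxes are OPEN; BSD is not proved by any of this. CONDITIONAL theorem on DISPLAYED
binders: Kobayashi 2003 Thm. 1.2 (`h12`) and Thm. 4.1 in its RATIONAL form (`h41`: `ξ^ε ∣ pⁿL_p^ε`, NO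
image hypothesis), the period-unit facts (`h5`, `h3`), the `p`-parity theorem (`hpar`), the datum-level
input `μ(X^ε) = 0` (`hμ`; on the small-image side it is supplied by a CM partner,
`mu_eq_zero_of_cmPartner`, or is automatic under surjectivity), and ONE certificate `(μ, λ)(L_p^ε) = (0, 1)`.
Sprung's functional equation is the tree theorem `cor414_sharpFlat_functionalEquation_apZero_holds`.
CALIBRATION / SUPPORT ONLY (pen rule D34-4 (3)).

## What this file does

`…SmallImageMuSaturationRankOne.lean` (`kobayashiMainConjecture_of_mu_eq_zero_of_cert_of_analyticRank_eq_one`,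
seat k3-c4) removed SURJECTIVITY from the rank-one squeeze (integral `ξ ∣ L_p^ε` from `μ(X^ε) = 0`,
`signedUpper_dvd_of_hasUnitContent`); part 1 of this family removed the ANALYTIC RANK (`T ∣ ξ^ε` from
parity, `X_dvd_of_charIdeal_eq_span_of_lam_eq_one`). This file removes both at once:

* `kobayashiMainConjecture_of_mu_eq_zero_of_lam_eq_one_of_p_parity` — odd good `p`, `a_p = 0`, NO image
  hypothesis, NO rank hypothesis: `h12`, `h41` (rational), `h5`, `h3`, `hpar`, `μ(X^ε) = 0` for every datum,
  certificate `(0, 1)` for the newform of level `N_E` ⟹ `KobayashiMainConjecture W p ε`.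

References: [Kobayashi2003] Thm. 1.2, Thm. 4.1, Conjecture (p. 2); [GreenbergVatsal2000] p. 4, §3 Rem. 3.4;
[DokchitserDokchitserAnnals2010] Thm. 1.4; [Sprung2017] Cor. 4.14.
-/

set_option autoImplicit false
set_option linter.dupNamespace false

noncomputable section

open scoped Classical MatrixGroups ModularForm

open CongruenceSubgroup PowerSeries WeierstrassCurve Literature.NumberTheory.EllipticCurves
  Literature.NumberTheory.EllipticCurves.ModularForms
  Literature.NumberTheory.EllipticCurves.Rank1Residual Literature.NumberTheory.EllipticCurves.Sprung2017
  Literature.NumberTheory.EllipticCurves.Kobayashi2003 ZpExtension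
  Literature.NumberTheory.EllipticCurves.GreenbergVatsal2000
  Literature.NumberTheory.EllipticCurves.Rank1Residual.Typed
  Summit.BirchSwinnertonDyer.Rank1Residual.X1.MuLambda
  Summit.BirchSwinnertonDyer.Rank1Residual.Supersingular

namespace Summit.BirchSwinnertonDyer.BirchSwinnertonDyer.Theorems.LargeImageParityStratum

variable (W : WeierstrassCurve ℚ) [W.IsElliptic] [W.IsGloballyMinimal] (p : ℕ) [Fact p.Prime]

/-- **IMAGE-FREE, RANK-FREE squeeze: `μ(X^ε) = 0` + `(μ, λ)(L_p^ε) = (0, 1)` + `p`-parity ⇒ Kobayashi's main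
conjecture for `(E, p, ε)`.** `p` odd good, `a_p = 0`; every dual datum of `Sel^ε(E/ℚ_∞)` has `μ = 0`
(`hμ`); for the newform `f₀` of level `N_E` the certificate `hcert₀` (`μ(L) = 0 ∧ λ(L) = 1` for every `L`
that is Pollack's `L_p^ε`). Granted BY NAME Kobayashi Thm. 1.2 (`h12`), Thm. 4.1 RATIONAL (`h41`), the
period-unit facts (`h5`, `h3`) and the `p`-parity theorem (`hpar`). Proof: `ξ ∣ L_p^ε` integrally from
`μ(X^ε) = 0` (`signedUpper_dvd_of_hasUnitContent`); `T ∣ ξ` by parity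
(`X_dvd_of_charIdeal_eq_span_of_lam_eq_one`, Sprung's functional equation fed by its tree proof); squeeze
`(ξ) = (L_p^ε)` (`span_eq_span_of_dvd_of_X_dvd_of_lam_eq_one`); `g := ϖ L_p^ε`, `ϖ ∈ ℤ_p^×`.
NO surjectivity, NO analytic rank, NO Gross–Zagier–Kolyvagin. PER PAIR in `hμ`/`hcert₀`; serves crux 3
(large image) and crux 4 (small image: `hμ` from a CM partner) alike.
[cite: Kobayashi2003, Thm. 1.2 (p. 2), Thm. 4.1 (p. 8) and Conjecture (p. 2)] [cite: GreenbergVatsal2000, p. 4 and §3 Remark 3.4]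
[cite: DokchitserDokchitserAnnals2010, Thm. 1.4] -/
theorem kobayashiMainConjecture_of_mu_eq_zero_of_lam_eq_one_of_p_parity
    (h12 : Kobayashi2003.thm12_signedSelmerDual_finite_torsion)
    (h41 : Kobayashi2003.thm41_signedCharIdeal_divisibility)
    (h5 : realPeriodRat_eq_unit_mul_plusPeriod) (h3 : realPeriodRat_eq_unit_mul_plusPeriod_three)
    (hpar : p_parity W p)
    (hp : p ≠ 2) (hgood : W.HasGoodReductionAtPrime p) (hap : W.frobeniusTrace p = 0) {ε : ℤˣ}
    (hμ : ∀ (κ : ZpExtension ℚ p) (γ : Field.absoluteGaloisGroup ℚ),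
      κ.IsCyclotomic → κ.IsTopGenerator γ → IsCyclotomicVariable p γ →
      ∀ (D : SignedSelmerDualData W κ γ ε), D.mu = 0)
    [NeZero (W.conductorNorm ℤ)] {f₀ : CuspForm (Gamma0 (W.conductorNorm ℤ)) 2} (hf₀ : IsNewformOf W f₀)
    (hcert₀ : ∀ L : IwasawaAlgebra p, IsSignedPAdicLFunction f₀ p ε L → mu L = 0 ∧ lam L = 1) :
    KobayashiMainConjecture W p ε := by
  intro κ γ hκ hγ hγ' _ f hf ϖ hϖ Lplus Lminus hPP D
  have hff : f = f₀ := hf.unique hf₀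
  subst hff
  haveI : Module.Finite (IwasawaAlgebra p) D.X := h12.moduleFinite hp hgood hap hκ hγ D
  have hX : Module.IsTorsion (IwasawaAlgebra p) D.X := h12.isTorsion hp hgood hap hκ hγ D
  refine ⟨hX, ?_⟩
  obtain ⟨ξ, hξ⟩ := (charIdeal_isPrincipal_holds p D.X).principal
  have hξ' : D.charIdeal = Ideal.span {ξ} := hξ
  have huξ : HasUnitContent ξ :=
    (muInvariant_eq_zero_iff_hasUnitContent D.X hX hξ').mp (hμ κ γ hκ hγ hγ' D)
  set L := kobayashiL ε Lplus Lminus with hL_def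
  have hL : IsSignedPAdicLFunction f p ε L := hPP.isSignedPAdicLFunction_kobayashiL ε
  -- (MC↑), INTEGRAL from `μ(X^ε) = 0`, no image hypothesis
  have hU : ξ ∣ L := signedUpper_dvd_of_hasUnitContent h41 hp hgood hap hf hκ hγ hγ' hL D hX hξ' huξ
  -- the certificate, and `T ∣ ξ` BY PARITY (no rank hypothesis)
  obtain ⟨hμL, hlam⟩ := hcert₀ L hL
  have hC : (X : IwasawaAlgebra p) ∣ ξ :=
    X_dvd_of_charIdeal_eq_span_of_lam_eq_one W p hpar cor414_sharpFlat_functionalEquation_apZero_holds hp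
      hgood hap hf hPP ε hlam hγ D hX hξ'
  have hspan : Ideal.span ({ξ} : Set (IwasawaAlgebra p)) = Ideal.span {L} :=
    span_eq_span_of_dvd_of_X_dvd_of_lam_eq_one hU hC hμL hlam
  -- the period ratio is a `p`-adic unit
  have hirr : W.HasIrreducibleModPGaloisRep p :=
    hasIrreducibleModPGaloisRep_of_dvd_frobeniusTrace W p hp
      (W.not_dvd_minimalDiscriminantInt_of_hasGoodReductionAtPrime' p hgood) (by rw [hap]; exact dvd_zero _)
  have hvϖ : padicValRat p ϖ = 0 := padicValRat_periodRatio_eq_zero h5 h3 W p hp hgood hirr f hf ϖ hϖ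
  have hϖ0 : ϖ ≠ 0 := by
    intro h0
    rw [h0, Rat.cast_zero, zero_mul] at hϖ
    exact (IsNewform0.plusPeriod_pos_holds hf.1 hf.coeffField_eq_bot).ne' hϖ.symm
  obtain ⟨u, hu⟩ := exists_units_coe_eq_ratCast hϖ0 hvϖ
  obtain ⟨hspan', hι⟩ := span_C_units_mul_eq u L
  refine ⟨C (u : ℤ_[p]) * L, ?_, ?_⟩
  · rw [hξ', hspan, hspan']
  · rw [hι, hu]

end Summit.BirchSwinnertonDyer.BirchSwinnertonDyer.Theorems.LargeImageParityStratum

end
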